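import Mathlib.RingTheory.ReesAlgebra
import Mathlib.RingTheory.GradedAlgebra.Basic
import Mathlib.Algebra.DirectSum.Module
import Mathlib.Algebra.Polynomial.Degree.Support
import Mathlib.AlgebraicGeometry.ProjectiveSpectrum.Proper
import Literature.AlgebraicGeometry.Resolution.ResolutionGlue
import HarnessLib

/-!
# The blowing up of an affine scheme along an ideal

Topic: `Literature/AlgebraicGeometry/Resolution`. Blowing ups are the morphisms out of which
resolutions of singularities are built (Hironaka 1964; Cossart–Piltant 2019, Thm. 1.5 and
Props. 4.3–4.6; Cossart–Jannsen–Saito 2020, Thm. 1.2); Mathlib has `Proj` of a graded ring and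
the Rees algebra `R[It] ⊆ R[t]` (`reesAlgebra`) but not their combination. This file constructs
the blowing up `Bl_I(Spec R) = Proj R[It] → Spec R` of an affine scheme along an ideal and PROVES
its basic properties over Mathlib:

* `reesGrading I n` — the grading `Iⁿtⁿ` of `R[It]`, a `GradedAlgebra` (`reesGrading.gradedAlgebra`,
  via `DirectSum.IsInternal`); `reesGrading.zeroRingHom : R →+* (R[It])₀` is bijective;
  `adjoin_range_reesT_eq_top`, `irrelevant_le_span_reesT` — `R[It]` resp. `R[It]₊` is
  generated by the `b t`, `b ∈ I`; `affineBlowup.iSup_basicOpen_reesT_eq_top` — the charts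
  `D₊(bt)`, `b ∈ I`, cover the blowing up;
* `affineBlowup I := Proj (reesGrading I)` and `affineBlowup.π I : Bl_I(Spec R) → Spec R`;
  `affineBlowup.isProper_of_fg` / `affineBlowup.isProper` — **proper** for `I` finitely
  generated, e.g. Noetherian `R` (Mathlib's properness of
  `Proj.toSpecZero` for graded algebras of finite type over the degree-zero part); separated;
* the chart of `a ∈ I`: `reesChart : (R[It])_{(at)} →+* R[1/a]` with
  `isLocalization_reesChart` — `R[1/a]` is the localization of the chart ring at `a/1`;
  `reesChartBase_mem_nonZeroDivisors`, `span_image_reesChartBase_eq` — on the chart ring the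
  ideal `I` becomes principal, generated by the nonzerodivisor `a/1` (the exceptional divisor is
  Cartier on the chart);
* `Proj.mem_toSpecZero_apply_iff` — `Proj.toSpecZero` on points (general graded rings; extracted
  from Mathlib's chart isomorphism), `Proj.genericPoint`, `Proj.dense_genericPoint`;
* `affineBlowup.reesT_notMem` — over `D(a)` the blowing up lies in the chart `D₊(at)`;
  `affineBlowup.awayι a ha : Spec R[1/a] → Bl_I(Spec R)` is an open immersion with range
  `π⁻¹(D(a))` (`affineBlowup.range_awayι`) and `awayι ≫ π = Spec (R → R[1/a])`;
* `isIso_morphismRestrict_of_isOpenImmersion` (restriction criterion) and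
  **`affineBlowup.isIso_morphismRestrict` — `π` is an isomorphism over `D(a)` for `a ∈ I`**,
  hence over the complement `⋃_{a ∈ I} D(a)` of `V(I)` (`affineBlowup.isIso_morphismRestrict_iSup`,
  `iSup_basicOpen_eq_compl_zeroLocus`);
* for a domain `R` and `I ≠ 0`: `affineBlowup.isBirational` — **`π` is birational**
  (`IsBirational` of `ResolutionOfSingularities.lean`), and `affineBlowup.isResolution` — a
  regular blowing up is a resolution of singularities (`IsResolution`).

## Sources

* R. Hartshorne, *Algebraic Geometry*, GTM 52, Ch. II §7 (blowing up; background only, all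
  cites below are to the Stacks Project).
* The Stacks Project, Tag 0804 (blowing up = Proj of the Rees algebra; affine blowup algebras
  `R[I/a]`, = Lemma 31.33.2), Tag 02OS (= Lemma 31.33.4 (1): the blowing up is an isomorphism
  away from the centre), Tag 02NS (= Lemma 31.33.13: projective, hence proper, for ideals of
  finite type), Tag 02ND (= Lemma 31.33.9: blowing up an integral scheme in a nonzero ideal gives
  an integral scheme) — all fetched and checked. [StacksProject]
* V. Cossart, O. Piltant, J. Algebra 529 (2019), §2.2. [CossartPiltant2019]

## Related files

* `LocalBlowup.lean` — the ring-level counterpart: the valuation-local chart `B[u/u₀]` of the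
  blowing up along an ideal (`IsLocalBlowupAlong`) and towers of local blowing ups; `reesChart`
  here realises the chart ring `(R[It])_{(at)}` inside `R[1/a]`.
* `Blowups.lean` — blowing ups of general schemes as a predicate (universal property).
* `AffineBlowupIntegral.lean` — integrality and surjectivity of `Bl_I(Spec R) → Spec R`.
-/

noncomputable section

open Polynomial AlgebraicGeometry CategoryTheory HomogeneousLocalization

namespace Literature.AlgebraicGeometry.Resolution

universe u

variable {R : Type u} [CommRing R] (I : Ideal R)

/-! ## The grading of the Rees algebra -/

/-- The degree-`n` piece `Iⁿ tⁿ` of the Rees algebra `R[It] ⊆ R[t]`: the elements whose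
underlying polynomial is a monomial of degree `n`. [folklore] -/
def reesGrading (n : ℕ) : Submodule R (reesAlgebra I) :=
  (LinearMap.range (monomial n : R →ₗ[R] R[X])).comap (reesAlgebra I).val.toLinearMap

/-- Membership in the degree-`n` piece. [folklore] -/
theorem mem_reesGrading_iff {n : ℕ} {p : reesAlgebra I} :
    p ∈ reesGrading I n ↔ ∃ r : R, monomial n r = (p : R[X]) :=
  Iff.rfl

/-- Membership in the degree-`n` piece, coefficient form. [folklore] -/
theorem mem_reesGrading_iff' {n : ℕ} {p : reesAlgebra I} :
    p ∈ reesGrading I n ↔ (p : R[X]) = monomial n ((p : R[X]).coeff n) := by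
  rw [mem_reesGrading_iff]
  constructor
  · rintro ⟨r, hr⟩
    rw [← hr, coeff_monomial, if_pos rfl]
  · intro h
    exact ⟨_, h.symm⟩

/-- The pieces `Iⁿ tⁿ` form a graded monoid (`1 ∈ I⁰t⁰`, `Iᵐtᵐ · Iⁿtⁿ ⊆ Iᵐ⁺ⁿtᵐ⁺ⁿ`). [folklore] -/
instance reesGrading.gradedMonoid : SetLike.GradedMonoid (reesGrading I) where
  one_mem := ⟨1, by simp⟩
  mul_mem := by
    rintro m n p q ⟨r, hr⟩ ⟨s, hs⟩
    have hr' : (p : R[X]) = monomial m r := hr.symm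
    have hs' : (q : R[X]) = monomial n s := hs.symm
    refine ⟨r * s, ?_⟩
    change monomial (m + n) (r * s) = (p : R[X]) * q
    rw [hr', hs', monomial_mul_monomial]

/-- The pieces `Iⁿ tⁿ` are independent. [folklore] -/
theorem reesGrading.iSupIndep : iSupIndep (reesGrading I) := by
  classical
  rw [iSupIndep_def]
  intro i
  -- elements with vanishing `i`-th coefficient
  let N : Submodule R (reesAlgebra I) :=
    LinearMap.ker ((lcoeff R i).comp (reesAlgebra I).val.toLinearMap)
  have hle : (⨆ (j) (_ : j ≠ i), reesGrading I j) ≤ N := by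
    refine iSup₂_le fun j hj p hp => ?_
    obtain ⟨r, hr⟩ := hp
    have hr' : (p : R[X]) = monomial j r := hr.symm
    change ((p : R[X])).coeff i = 0
    rw [hr', coeff_monomial, if_neg hj]
  refine Disjoint.mono_right hle ?_
  rw [Submodule.disjoint_def]
  intro p hp hpN
  obtain ⟨r, hr⟩ := hp
  have hr' : (p : R[X]) = monomial i r := hr.symm
  have h0 : ((p : R[X])).coeff i = 0 := hpN
  rw [hr', coeff_monomial, if_pos rfl] at h0
  apply Subtype.ext
  change (p : R[X]) = 0
  rw [hr', h0, map_zero]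

/-- The pieces `Iⁿ tⁿ` span the Rees algebra. [folklore] -/
theorem reesGrading.iSup_eq_top : ⨆ n, reesGrading I n = ⊤ := by
  classical
  rw [eq_top_iff]
  rintro p -
  have hp : p = ∑ n ∈ (p : R[X]).support,
      (⟨monomial n ((p : R[X]).coeff n), reesAlgebra.monomial_mem.mpr (p.2 n)⟩ : reesAlgebra I) := by
    apply Subtype.ext
    rw [AddSubmonoidClass.coe_finsetSum]
    exact (p : R[X]).as_sum_support
  rw [hp]
  refine Submodule.sum_mem _ fun n _ => ?_
  exact Submodule.mem_iSup_of_mem n ⟨_, rfl⟩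

/-- `R[It] = ⨁ₙ Iⁿtⁿ` internally. [folklore] -/
theorem reesGrading.isInternal : DirectSum.IsInternal (reesGrading I) :=
  DirectSum.isInternal_submodule_of_iSupIndep_of_iSup_eq_top (reesGrading.iSupIndep I)
    (reesGrading.iSup_eq_top I)

/-- **The Rees algebra as an `ℕ`-graded `R`-algebra** (decomposition conjured from
`reesGrading.isInternal`). [folklore] -/
instance reesGrading.gradedAlgebra : GradedAlgebra (reesGrading I) where
  toDecomposition := (reesGrading.isInternal I).chooseDecomposition

/-! ## Degree zero -/

/-- The structure map `R → I⁰t⁰ = (R[It])₀`, `r ↦ r`. [folklore] -/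
def reesGrading.zeroRingHom : R →+* reesGrading I 0 where
  toFun r := ⟨algebraMap R (reesAlgebra I) r, r, by rw [monomial_zero_left]; rfl⟩
  map_one' := Subtype.ext (map_one _)
  map_mul' r s := Subtype.ext (map_mul _ r s)
  map_zero' := Subtype.ext (map_zero _)
  map_add' r s := Subtype.ext (map_add _ r s)

/-- `reesGrading.zeroRingHom` followed by the inclusion into `R[It]` is the structure map.
[folklore] -/
theorem reesGrading.coe_zeroRingHom (r : R) :
    ((reesGrading.zeroRingHom I r : reesGrading I 0) : reesAlgebra I) =
      algebraMap R (reesAlgebra I) r :=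
  rfl

/-- The degree-`0` piece is the image of `R`: `R → I⁰t⁰` is bijective. [folklore] -/
theorem reesGrading.zeroRingHom_bijective :
    Function.Bijective (reesGrading.zeroRingHom I) := by
  constructor
  · intro r s h
    have : (algebraMap R (reesAlgebra I) r : R[X]) = algebraMap R (reesAlgebra I) s :=
      congrArg (fun p : reesGrading I 0 => ((p : reesAlgebra I) : R[X])) h
    simpa using this
  · rintro ⟨p, r, hr⟩
    have hr' : (p : R[X]) = monomial 0 r := hr.symm
    refine ⟨r, Subtype.ext (Subtype.ext ?_)⟩
    change (algebraMap R (reesAlgebra I) r : R[X]) = p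
    rw [hr', monomial_zero_left]
    rfl

/-- `R ≃+* I⁰t⁰`. [folklore] -/
def reesGrading.zeroEquiv : R ≃+* reesGrading I 0 :=
  RingEquiv.ofBijective _ (reesGrading.zeroRingHom_bijective I)

/-- The Rees algebra of a finitely generated ideal is of finite type over its degree-`0` piece
(Mathlib `reesAlgebra.fg`). [folklore] -/
theorem reesGrading.finiteType_zero_of_fg (hI : I.FG) :
    Algebra.FiniteType (reesGrading I 0) (reesAlgebra I) := by
  haveI : Algebra.FiniteType R (reesAlgebra I) :=
    (reesAlgebra I).fg_iff_finiteType.mp (reesAlgebra.fg hI)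
  haveI : IsScalarTower R (reesGrading I 0) (reesAlgebra I) :=
    IsScalarTower.of_algebraMap_eq (R := R) (S := reesGrading I 0) (A := reesAlgebra I)
      fun r => rfl
  exact Algebra.FiniteType.of_restrictScalars_finiteType R (reesGrading I 0) (reesAlgebra I)

/-- The Rees algebra is of finite type over its degree-`0` piece when `R` is Noetherian.
[folklore] -/
instance reesGrading.finiteType_zero [IsNoetherianRing R] :
    Algebra.FiniteType (reesGrading I 0) (reesAlgebra I) :=
  reesGrading.finiteType_zero_of_fg I (IsNoetherian.noetherian I)

/-! ## The blowing up -/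

/-- **The blowing up `Bl_I(Spec R) = Proj R[It]`** of the affine scheme `Spec R` along the ideal
`I` (Hartshorne II.7; Stacks 01OG: the blowing up is the relative Proj of the Rees
algebra `⨁ Iⁿ`). [cite: StacksProject, Tag 0804] -/
abbrev affineBlowup : Scheme.{u} :=
  Proj (reesGrading I)

/-- The structure morphism `Bl_I(Spec R) → Spec R` (`Proj R[It] → Spec (R[It])₀ = Spec R`).
[cite: StacksProject, Tag 0804] -/
def affineBlowup.π : affineBlowup I ⟶ Spec (.of R) :=
  Proj.toSpecZero (reesGrading I) ≫ Spec.map (CommRingCat.ofHom (R := R) (S := reesGrading I 0) (reesGrading.zeroRingHom I))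

/-- `Spec (R[It])₀ → Spec R` is an isomorphism. [folklore] -/
instance affineBlowup.isIso_specMap_zeroRingHom :
    IsIso (Spec.map (CommRingCat.ofHom (R := R) (S := reesGrading I 0) (reesGrading.zeroRingHom I))) := by
  have hb : Function.Bijective ((forget CommRingCat).map
      (CommRingCat.ofHom (R := R) (S := reesGrading I 0) (reesGrading.zeroRingHom I))) :=
    reesGrading.zeroRingHom_bijective I
  have : IsIso ((forget CommRingCat).map
      (CommRingCat.ofHom (R := R) (S := reesGrading I 0) (reesGrading.zeroRingHom I))) :=
    (isIso_iff_bijective _).mpr hb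
  have : IsIso (CommRingCat.ofHom (R := R) (S := reesGrading I 0) (reesGrading.zeroRingHom I)) :=
    isIso_of_reflects_iso _ (forget CommRingCat)
  infer_instance

/-- **The blowing up of an affine scheme along a finitely generated ideal is proper** (it is
`Proj` of a graded algebra of finite type over its degree-zero part `R`; Stacks 02NS =
Lemma 31.33.13: the blowing up in an ideal sheaf of finite type is projective, in particular
proper — here via Mathlib's properness of `Proj.toSpecZero`). [cite: StacksProject, Tag 02NS] -/
theorem affineBlowup.isProper_of_fg (hI : I.FG) : IsProper (affineBlowup.π I) := by
  haveI := reesGrading.finiteType_zero_of_fg I hI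
  change IsProper (Proj.toSpecZero (reesGrading I) ≫ _)
  rw [MorphismProperty.cancel_right_of_respectsIso (P := @IsProper)]
  infer_instance

/-- The blowing up of a Noetherian affine scheme is proper. [cite: StacksProject, Tag 02NS] -/
instance affineBlowup.isProper [IsNoetherianRing R] : IsProper (affineBlowup.π I) :=
  affineBlowup.isProper_of_fg I (IsNoetherian.noetherian I)

/-- The blowing up is separated. [folklore] -/
instance affineBlowup.isSeparated : (affineBlowup I).IsSeparated := by
  unfold affineBlowup
  infer_instance

/-! ## The chart of `a ∈ I`: `(R[It])_{(at)} → R[1/a]` -/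

section Chart

variable {I}
variable (a : R) (ha : a ∈ I)

/-- The degree-one element `a t ∈ R[It]` for `a ∈ I`. [folklore] -/
def reesT : reesAlgebra I :=
  ⟨monomial 1 a, reesAlgebra.monomial_mem.mpr (by simpa using ha)⟩

/-- `(a t : R[t]) = monomial 1 a`. [folklore] -/
theorem coe_reesT : (reesT a ha : R[X]) = monomial 1 a :=
  rfl

/-- `a t` has degree one. [folklore] -/
theorem reesT_mem : reesT a ha ∈ reesGrading I 1 :=
  ⟨a, rfl⟩

/-- Evaluation at `t = 1`: the ring map `R[It] ⊆ R[t] → R[1/a]`, `x tⁿ ↦ x`. [folklore] -/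
def reesEval : reesAlgebra I →+* Localization.Away a :=
  (eval₂RingHom (algebraMap R (Localization.Away a)) 1).comp (reesAlgebra I).val.toRingHom

/-- `reesEval` on an element with underlying polynomial `monomial n r` is `r`. [folklore] -/
theorem reesEval_of_eq_monomial {x : reesAlgebra I} {n : ℕ} {r : R} (h : (x : R[X]) = monomial n r) :
    reesEval a x = algebraMap R (Localization.Away a) r := by
  change eval₂ (algebraMap R (Localization.Away a)) 1 (x : R[X]) = _
  rw [h, eval₂_monomial, one_pow, mul_one]

/-- `reesEval (a t) = a` is a unit of `R[1/a]`. [folklore] -/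
theorem isUnit_reesEval_reesT : IsUnit (reesEval a (reesT a ha)) := by
  rw [reesEval_of_eq_monomial a (coe_reesT a ha)]
  exact IsLocalization.Away.algebraMap_isUnit a

/-- **The chart map `ψ : (R[It])_{(at)} → R[1/a]`**, `(x tⁿ)/(a t)ⁿ ↦ x / aⁿ`: the
homogeneous localization `(R[It])_{(at)}` (coordinate ring of the chart `D₊(at)` of the blowing
up, the "affine blowup algebra" `R[I/a]`) maps to `R[1/a]` (injectively, onto `R[I/a]`; we only
use that `R[1/a]` becomes the localization of the chart at `a`). [cite: StacksProject, Tag 0804] -/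
def reesChart : HomogeneousLocalization.Away (reesGrading I) (reesT a ha) →+* Localization.Away a :=
  (IsLocalization.Away.lift (reesT a ha) (g := reesEval a) (isUnit_reesEval_reesT a ha) :
      Localization.Away (reesT a ha) →+* Localization.Away a).comp
    (algebraMap (HomogeneousLocalization.Away (reesGrading I) (reesT a ha))
      (Localization.Away (reesT a ha)))

/-- `ψ` on a fraction `x/(at)ⁿ`: `ψ(x/(at)ⁿ) · aⁿ = x(1)`. [folklore] -/
theorem reesChart_mk_mul_pow (n : ℕ) (x : reesAlgebra I) (hx : x ∈ reesGrading I (n • 1)) :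
    reesChart a ha (HomogeneousLocalization.Away.mk (reesGrading I) (reesT_mem a ha) n x hx) *
      algebraMap R (Localization.Away a) a ^ n = reesEval a x := by
  have hunit := isUnit_reesEval_reesT a ha
  have hA : algebraMap R (Localization.Away a) a ^ n = IsLocalization.Away.lift (reesT a ha) hunit
      (algebraMap _ (Localization.Away (reesT a ha)) (reesT a ha ^ n)) := by
    rw [IsLocalization.Away.lift_eq, map_pow, reesEval_of_eq_monomial a (coe_reesT a ha)]
  change IsLocalization.Away.lift (reesT a ha) hunit
      ((HomogeneousLocalization.Away.mk (reesGrading I) (reesT_mem a ha) n x hx).val) * _ = _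
  rw [hA, ← map_mul, HomogeneousLocalization.Away.val_mk, Localization.mk_eq_mk']
  erw [IsLocalization.mk'_spec]
  rw [IsLocalization.Away.lift_eq]

/-- The structure map `φ : R → (R[It])_{(at)}`, `r ↦ r/1`. [folklore] -/
def reesChartBase : R →+* HomogeneousLocalization.Away (reesGrading I) (reesT a ha) :=
  (HomogeneousLocalization.fromZeroRingHom (reesGrading I) _).comp (reesGrading.zeroRingHom I)

/-- `ψ ∘ φ = (R → R[1/a])`. [folklore] -/
theorem reesChart_comp_reesChartBase :
    (reesChart a ha).comp (reesChartBase a ha) = algebraMap R (Localization.Away a) := by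
  ext r
  have hunit := isUnit_reesEval_reesT a ha
  change IsLocalization.Away.lift (reesT a ha) hunit
    (HomogeneousLocalization.val (HomogeneousLocalization.mk _)) = _
  rw [HomogeneousLocalization.val_mk]
  change IsLocalization.Away.lift (reesT a ha) hunit
    (Localization.mk (algebraMap R (reesAlgebra I) r) 1) = _
  rw [Localization.mk_one_eq_algebraMap, IsLocalization.Away.lift_eq]
  exact reesEval_of_eq_monomial a (n := 0) (by rw [monomial_zero_left]; rfl)

/-- `ψ (φ r) = r`. [folklore] -/
theorem reesChart_reesChartBase (r : R) :
    reesChart a ha (reesChartBase a ha r) = algebraMap R (Localization.Away a) r :=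
  RingHom.congr_fun (reesChart_comp_reesChartBase a ha) r

/-- The numerator `x aᵐ tᵐ ∈ Iᵐtᵐ` used to write `x/aᵐ` as `ψ((x aᵐ tᵐ)/(a t)ᵐ)`. [folklore] -/
def reesNum (r : R) (m : ℕ) : reesAlgebra I :=
  ⟨monomial m (r * a ^ m), reesAlgebra.monomial_mem.mpr (Ideal.mul_mem_left _ r (Ideal.pow_mem_pow ha m))⟩

/-- `reesNum` has degree `m`. [folklore] -/
theorem reesNum_mem (r : R) (m : ℕ) : reesNum a ha r m ∈ reesGrading I (m • 1) := by
  rw [smul_eq_mul, mul_one]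
  exact ⟨_, rfl⟩

/-- The value of a degree-`0` fraction `r/1`. [folklore] -/
theorem val_reesChartBase (r : R) :
    (reesChartBase a ha r).val = Localization.mk (algebraMap R (reesAlgebra I) r) 1 :=
  rfl

/-- **`R[1/a]` is the localization of the chart ring `(R[It])_{(at)}` at `a/1`** (via `ψ`):
`(R[It])_{(at)}[1/a] = R[I/a][1/a] = R[1/a]`. [cite: StacksProject, Tag 0804] -/
theorem isLocalization_reesChart :
    letI := (reesChart a ha).toAlgebra
    IsLocalization.Away (reesChartBase a ha a) (Localization.Away a) := by
  letI := (reesChart a ha).toAlgebra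
  have hψ : ∀ y, algebraMap (HomogeneousLocalization.Away (reesGrading I) (reesT a ha))
      (Localization.Away a) y = reesChart a ha y := fun _ => rfl
  have hAu : IsUnit (algebraMap R (Localization.Away a) a) := IsLocalization.Away.algebraMap_isUnit a
  constructor; constructor
  · rintro ⟨_, k, rfl⟩
    rw [hψ, map_pow, reesChart_reesChartBase]
    exact hAu.pow k
  · intro z
    obtain ⟨⟨r, s⟩, rfl⟩ := IsLocalization.mk'_surjective (Submonoid.powers a) z
    obtain ⟨_, m, hm⟩ := s
    subst hm
    let y := HomogeneousLocalization.Away.mk (reesGrading I) (reesT_mem a ha) m (reesNum a ha r m)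
      (reesNum_mem a ha r m)
    have h1 : reesChart a ha y * algebraMap R _ a ^ m = algebraMap R _ r * algebraMap R _ a ^ m := by
      rw [reesChart_mk_mul_pow, reesEval_of_eq_monomial a rfl, map_mul, map_pow]
    have h2 : reesChart a ha y = algebraMap R _ r := (IsUnit.mul_left_inj (hAu.pow m)).mp h1
    refine ⟨(y, ⟨_, m, rfl⟩), ?_⟩
    change IsLocalization.mk' _ r ⟨a ^ m, _⟩ * reesChart a ha (reesChartBase a ha a ^ m) =
      reesChart a ha y
    rw [RingHom.map_pow, reesChart_reesChartBase, h2, ← RingHom.map_pow]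
    exact IsLocalization.mk'_spec _ r ⟨a ^ m, _⟩
  · intro y₁ y₂ h
    obtain ⟨n₁, x₁, hx₁, rfl⟩ :=
      HomogeneousLocalization.Away.mk_surjective (reesGrading I) (reesT_mem a ha) y₁
    obtain ⟨n₂, x₂, hx₂, rfl⟩ :=
      HomogeneousLocalization.Away.mk_surjective (reesGrading I) (reesT_mem a ha) y₂
    obtain ⟨r₁, hr₁⟩ := hx₁
    obtain ⟨r₂, hr₂⟩ := hx₂
    have hr₁' : (x₁ : R[X]) = monomial (n₁ • 1) r₁ := hr₁.symm
    have hr₂' : (x₂ : R[X]) = monomial (n₂ • 1) r₂ := hr₂.symm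
    rw [hψ, hψ] at h
    have e₁ := reesChart_mk_mul_pow a ha n₁ x₁ ⟨r₁, hr₁⟩
    have e₂ := reesChart_mk_mul_pow a ha n₂ x₂ ⟨r₂, hr₂⟩
    rw [reesEval_of_eq_monomial a hr₁'] at e₁
    rw [reesEval_of_eq_monomial a hr₂'] at e₂
    -- `r₁ a^{n₂} = r₂ a^{n₁}` in `R[1/a]`
    have e : algebraMap R (Localization.Away a) (r₁ * a ^ n₂) =
        algebraMap R (Localization.Away a) (r₂ * a ^ n₁) := by
      rw [map_mul, map_mul, map_pow, map_pow, ← e₁, ← e₂, h]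
      ring
    obtain ⟨⟨_, k, rfl⟩, hc⟩ := (IsLocalization.eq_iff_exists (Submonoid.powers a) _).mp e
    refine ⟨⟨_, k, rfl⟩, ?_⟩
    apply HomogeneousLocalization.val_injective
    change ((reesChartBase a ha a) ^ k * _).val = ((reesChartBase a ha a) ^ k * _).val
    rw [HomogeneousLocalization.val_mul, HomogeneousLocalization.val_mul,
      HomogeneousLocalization.val_pow, val_reesChartBase,
      HomogeneousLocalization.Away.val_mk, HomogeneousLocalization.Away.val_mk,
      Localization.mk_pow, Localization.mk_mul, Localization.mk_mul, Localization.mk_eq_mk_iff,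
      Localization.r_iff_exists]
    refine ⟨1, ?_⟩
    simp only [OneMemClass.coe_one, one_mul, Submonoid.coe_mul, SubmonoidClass.coe_pow]
    apply Subtype.ext
    simp only [Subalgebra.coe_mul, Subalgebra.coe_pow, coe_reesT, hr₁', hr₂',
      one_pow, one_mul, Subalgebra.coe_algebraMap, ← Polynomial.C_eq_algebraMap]
    simp only [smul_eq_mul, mul_one, monomial_pow, ← C_pow, C_mul_monomial, monomial_mul_monomial,
      one_mul]
    rw [add_comm n₂ n₁]
    congr 1
    change a ^ k * (r₁ * a ^ n₂) = a ^ k * (r₂ * a ^ n₁) at hc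
    linear_combination hc

/-- The value of `x/(at)ⁿ · r/1`-type products: `val (φ r) = r/1`. [folklore] -/
theorem val_reesChartBase_eq_mk (r : R) :
    (reesChartBase a ha r).val =
      Localization.mk (algebraMap R (reesAlgebra I) r) (1 : Submonoid.powers (reesT a ha)) :=
  rfl

/-- **On the chart `D₊(at)` the element `a/1` is a nonzerodivisor** (Stacks 0804/052P: the image
of `a` in the affine blowup algebra `R[I/a]` is a nonzerodivisor): `(x tⁿ)/(at)ⁿ · a = 0` forces
`aᵐ⁺¹ x = 0` for some `m`, i.e. `(x tⁿ)/(at)ⁿ = 0`. [cite: StacksProject, Tag 0804] -/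
theorem reesChartBase_mem_nonZeroDivisors :
    reesChartBase a ha a ∈ nonZeroDivisors (HomogeneousLocalization.Away (reesGrading I) (reesT a ha)) := by
  have key : ∀ y : HomogeneousLocalization.Away (reesGrading I) (reesT a ha),
      y * reesChartBase a ha a = 0 → y = 0 := by
    intro y hy
    obtain ⟨n, x, hx, rfl⟩ :=
      HomogeneousLocalization.Away.mk_surjective (reesGrading I) (reesT_mem a ha) y
    obtain ⟨r, hr⟩ := hx
    have hr' : (x : R[X]) = monomial (n • 1) r := hr.symm
    -- `y · a/1 = 0` in the localization: `(at)^m · (x · a) = 0` in `R[It]`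
    have h0 := congrArg HomogeneousLocalization.val hy
    rw [HomogeneousLocalization.val_mul, HomogeneousLocalization.val_zero,
      HomogeneousLocalization.Away.val_mk, val_reesChartBase_eq_mk, Localization.mk_mul,
      Localization.mk_eq_mk', IsLocalization.mk'_eq_zero_iff] at h0
    obtain ⟨⟨_, m, rfl⟩, hm⟩ := h0
    -- hence `a^(m+1) r = 0`
    have hzero : a ^ (m + 1) * r = 0 := by
      have := congrArg (fun p : reesAlgebra I => (p : R[X]).coeff (m + (n • 1))) hm
      simp only [Subalgebra.coe_mul, Subalgebra.coe_pow, coe_reesT, hr', Subalgebra.coe_algebraMap,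
        ← Polynomial.C_eq_algebraMap, monomial_pow, monomial_mul_C, monomial_mul_monomial,
        coeff_monomial, ZeroMemClass.coe_zero, coeff_zero, one_mul, if_true] at this
      linear_combination this
    -- so `y = (x tⁿ)/(at)ⁿ = 0`: `(at)^(m+1) x = 0`
    apply HomogeneousLocalization.val_injective
    rw [HomogeneousLocalization.Away.val_mk, HomogeneousLocalization.val_zero, Localization.mk_eq_mk',
      IsLocalization.mk'_eq_zero_iff]
    refine ⟨⟨_, m + 1, rfl⟩, Subtype.ext ?_⟩
    simp only [Subalgebra.coe_mul, Subalgebra.coe_pow, coe_reesT, hr', monomial_pow,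
      monomial_mul_monomial, ZeroMemClass.coe_zero, hzero, map_zero]
  change _ ∈ nonZeroDivisorsLeft _ ⊓ nonZeroDivisorsRight _
  refine Submonoid.mem_inf.mpr ⟨?_, ?_⟩
  · exact (mem_nonZeroDivisorsLeft_iff _).mpr fun y hy =>
      key y ((mul_comm y (reesChartBase a ha a)).trans hy)
  · exact (mem_nonZeroDivisorsRight_iff _).mpr key

/-- **On the chart `D₊(at)` the ideal `I` becomes principal, generated by `a/1`**:
`I · (R[It])_{(at)} = (a/1)` since `c/1 = a/1 · (c t)/(a t)` for `c ∈ I` (Stacks 0804; with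
`reesChartBase_mem_nonZeroDivisors`: the exceptional ideal is invertible on the chart).
[cite: StacksProject, Tag 0804] -/
theorem span_image_reesChartBase_eq :
    Ideal.span (reesChartBase a ha '' (I : Set R)) = Ideal.span {reesChartBase a ha a} := by
  apply le_antisymm
  · rw [Ideal.span_le]
    rintro _ ⟨c, hc, rfl⟩
    -- `c/1 = a/1 · (ct)/(at)`
    have hw : reesT c hc ∈ reesGrading I (1 • 1) := by rw [one_smul]; exact reesT_mem c hc
    have : reesChartBase a ha c = reesChartBase a ha a *
        HomogeneousLocalization.Away.mk (reesGrading I) (reesT_mem a ha) 1 (reesT c hc) hw := by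
      apply HomogeneousLocalization.val_injective
      rw [HomogeneousLocalization.val_mul, val_reesChartBase_eq_mk, val_reesChartBase_eq_mk,
        HomogeneousLocalization.Away.val_mk, Localization.mk_mul, Localization.mk_eq_mk_iff,
        Localization.r_iff_exists]
      refine ⟨1, Subtype.ext ?_⟩
      simp only [OneMemClass.coe_one, one_mul, Subalgebra.coe_mul, coe_reesT,
        Subalgebra.coe_algebraMap, ← Polynomial.C_eq_algebraMap, pow_one, monomial_mul_C,
        C_mul_monomial]
    rw [this]
    exact Ideal.mul_mem_right _ _ (Ideal.subset_span rfl)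
  · rw [Ideal.span_le, Set.singleton_subset_iff]
    exact Ideal.subset_span ⟨a, ha, rfl⟩

end Chart

/-- `R[It]` is generated over `R` by the degree-one elements `b t`, `b ∈ I` (Mathlib
`adjoin_monomial_eq_reesAlgebra`, transported into `R[It]`). [folklore] -/
theorem adjoin_range_reesT_eq_top :
    Algebra.adjoin R (Set.range (fun b : I => reesT (I := I) b.1 b.2)) = ⊤ := by
  apply Subalgebra.map_injective (f := (reesAlgebra I).val) Subtype.val_injective
  rw [Algebra.map_top, Subalgebra.range_val, AlgHom.map_adjoin]
  have : ((reesAlgebra I).val : reesAlgebra I → R[X]) '' Set.range (fun b : I => reesT (I := I) b.1 b.2) =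
      (Submodule.map (monomial 1 : R →ₗ[R] R[X]) I : Set R[X]) := by
    apply Set.Subset.antisymm
    · rintro _ ⟨_, ⟨b, rfl⟩, rfl⟩
      exact ⟨b.1, b.2, rfl⟩
    · rintro _ ⟨b, hb, rfl⟩
      exact ⟨reesT b hb, ⟨⟨b, hb⟩, rfl⟩, rfl⟩
  rw [this]
  exact adjoin_monomial_eq_reesAlgebra I

/-- A homogeneous element `r tⁱ`, `i ≥ 1`, of `R[It]` lies in the ideal generated by the `b t`,
`b ∈ I` (write `r ∈ Iⁱ = I · Iⁱ⁻¹` as a sum of products `b c`). [folklore] -/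
theorem monomial_mem_span_reesT {i : ℕ} (hi : i ≠ 0) {r : R} (hr : r ∈ I ^ i) :
    (⟨monomial i r, reesAlgebra.monomial_mem.mpr hr⟩ : reesAlgebra I) ∈
      Ideal.span (Set.range (fun b : I => reesT (I := I) b.1 b.2)) := by
  obtain ⟨j, rfl⟩ : ∃ j, i = j + 1 := ⟨i - 1, (Nat.succ_pred_eq_of_ne_zero hi).symm⟩
  -- the set of `r ∈ I^(j+1)` whose monomial lies in the span is an additive subgroup containing
  -- the products `b c`, `b ∈ I`, `c ∈ I^j`
  let S : Set R := {r | ∃ hr : r ∈ I ^ (j + 1),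
    (⟨monomial (j + 1) r, reesAlgebra.monomial_mem.mpr hr⟩ : reesAlgebra I) ∈
      Ideal.span (Set.range (fun b : I => reesT (I := I) b.1 b.2))}
  suffices h : r ∈ S by
    obtain ⟨hr', h⟩ := h
    exact h
  have hr' : r ∈ I * I ^ j := by rwa [← pow_succ']
  refine Submodule.mul_induction_on hr' (fun b hb c hc => ?_) (fun x y hx hy => ?_)
  · have hbc : b * c ∈ I ^ (j + 1) := by rw [pow_succ']; exact Ideal.mul_mem_mul hb hc
    refine ⟨hbc, ?_⟩
    have hw : monomial j c ∈ reesAlgebra I := reesAlgebra.monomial_mem.mpr hc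
    have : (⟨monomial (j + 1) (b * c), reesAlgebra.monomial_mem.mpr hbc⟩ : reesAlgebra I) =
        reesT b hb * ⟨monomial j c, hw⟩ := by
      apply Subtype.ext
      change monomial (j + 1) (b * c) = monomial 1 b * monomial j c
      rw [monomial_mul_monomial, add_comm]
    rw [this]
    exact Ideal.mul_mem_right _ _ (Ideal.subset_span ⟨⟨b, hb⟩, rfl⟩)
  · obtain ⟨hx', hx⟩ := hx
    obtain ⟨hy', hy⟩ := hy
    refine ⟨Ideal.add_mem _ hx' hy', ?_⟩
    have : (⟨monomial (j + 1) (x + y), reesAlgebra.monomial_mem.mpr (Ideal.add_mem _ hx' hy')⟩ :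
        reesAlgebra I) = ⟨monomial (j + 1) x, reesAlgebra.monomial_mem.mpr hx'⟩ +
          ⟨monomial (j + 1) y, reesAlgebra.monomial_mem.mpr hy'⟩ := by
      apply Subtype.ext
      change monomial (j + 1) (x + y) = monomial (j + 1) x + monomial (j + 1) y
      rw [map_add]
    rw [this]
    exact Ideal.add_mem _ hx hy

/-- The irrelevant ideal `R[It]₊ = ⨁_{n ≥ 1} Iⁿtⁿ` is generated by the degree-one elements
`b t`, `b ∈ I`. [folklore] -/
theorem irrelevant_le_span_reesT :
    (HomogeneousIdeal.irrelevant (reesGrading I)).toIdeal ≤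
      Ideal.span (Set.range (fun b : I => reesT (I := I) b.1 b.2)) := by
  classical
  intro z hz
  replace hz : z ∈ HomogeneousIdeal.irrelevant (reesGrading I) := hz
  rw [HomogeneousIdeal.mem_irrelevant_iff, GradedRing.proj_apply] at hz
  rw [← DirectSum.sum_support_decompose (reesGrading I) z]
  refine Ideal.sum_mem _ fun i _ => ?_
  by_cases hi : i = 0
  · subst hi
    rw [hz]
    exact Ideal.zero_mem _
  · obtain ⟨r, hr⟩ := (DirectSum.decompose (reesGrading I) z i).2
    have hr' : ((DirectSum.decompose (reesGrading I) z i : reesAlgebra I) : R[X]) = monomial i r :=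
      hr.symm
    have hrI : r ∈ I ^ i := by
      have := (DirectSum.decompose (reesGrading I) z i : reesAlgebra I).2 i
      rwa [hr', coeff_monomial, if_pos rfl] at this
    have : (DirectSum.decompose (reesGrading I) z i : reesAlgebra I) =
        ⟨monomial i r, reesAlgebra.monomial_mem.mpr hrI⟩ := Subtype.ext hr'
    rw [this]
    exact monomial_mem_span_reesT I hi hrI

/-- **The charts `D₊(bt)`, `b ∈ I`, cover the blowing up** (Stacks 0804: "`b⁻¹(U)` has an
affine open covering by spectra of the affine blowup algebras `A[I/a]`").
[cite: StacksProject, Tag 0804] -/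
theorem affineBlowup.iSup_basicOpen_reesT_eq_top :
    ⨆ b : I, Proj.basicOpen (reesGrading I) (reesT (I := I) b.1 b.2) = ⊤ :=
  Proj.iSup_basicOpen_eq_top (reesGrading I) (fun b : I => reesT (I := I) b.1 b.2)
    (irrelevant_le_span_reesT I)

/-! ## `Proj.toSpecZero` on points (general graded rings) -/

section ProjPoints

variable {σ : Type*} {A : Type u} [CommRing A] [SetLike σ A] [AddSubgroupClass σ A]
variable (𝒜 : ℕ → σ) [GradedRing 𝒜]

set_option backward.isDefEq.respectTransparency false in
/-- The scheme-level chart map `Proj|_{D₊(f)} → Spec A⁰_f` of Mathlib is, as a morphism of locally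
ringed spaces, the explicit `ProjectiveSpectrum.Proj.toSpec` (extracted from Mathlib's proof of
`Proj.basicOpenIsoSpec`). [folklore] -/
theorem Proj.basicOpenToSpec_toLRSHom (f : A) :
    Scheme.forgetToLocallyRingedSpace.map (Proj.basicOpenToSpec 𝒜 f) =
      ProjectiveSpectrum.Proj.toSpec 𝒜 f := by
  refine Eq.trans ?_ (ΓSpec.locallyRingedSpaceAdjunction.homEquiv_apply _ _ _).symm
  dsimp [Proj.basicOpenToSpec, Scheme.Opens.toSpecΓ]
  simp only [Category.assoc, ← Spec.map_comp]
  rfl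

/-- Points of the chart map: `z ∈ (Proj|_{D₊(f)} → Spec A⁰_f)(x)` iff the numerator of `z` lies
in `x`. [folklore] -/
theorem Proj.mk_mem_basicOpenToSpec_apply (f : A) (x : ↥(Proj.basicOpen 𝒜 f))
    (z : NumDenSameDeg 𝒜 (.powers f)) :
    HomogeneousLocalization.mk z ∈ (Proj.basicOpenToSpec 𝒜 f x).asIdeal ↔
      z.num.1 ∈ x.1.asHomogeneousIdeal := by
  have : (Proj.basicOpenToSpec 𝒜 f).base x = (ProjectiveSpectrum.Proj.toSpec 𝒜 f).base x := by
    rw [← Proj.basicOpenToSpec_toLRSHom]; rfl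
  change HomogeneousLocalization.mk z ∈ ((Proj.basicOpenToSpec 𝒜 f).base x).asIdeal ↔ _
  rw [this]
  exact ProjectiveSpectrum.Proj.mk_mem_toSpec_base_apply 𝒜 x z

/-- **`Proj.toSpecZero` on points**: the image in `Spec 𝒜₀` of a relevant homogeneous prime `x`
is its degree-zero part `x ∩ 𝒜₀`. [folklore] -/
theorem Proj.mem_toSpecZero_apply_iff (x : Proj 𝒜) (s : 𝒜 0) :
    s ∈ (Proj.toSpecZero 𝒜 x).asIdeal ↔ (s : A) ∈ x.asHomogeneousIdeal := by
  let y : ↥(Proj.basicOpen 𝒜 (1 : A)) :=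
    ((Proj 𝒜).topIso.inv ≫ ((Proj 𝒜).isoOfEq (Proj.basicOpen_one 𝒜)).inv) x
  have hy : (y : Proj 𝒜) = x := by
    change ((Proj 𝒜).topIso.inv ≫ ((Proj 𝒜).isoOfEq (Proj.basicOpen_one 𝒜)).inv ≫
      (Proj.basicOpen 𝒜 (1 : A)).ι) x = x
    rw [Scheme.isoOfEq_inv_ι, Scheme.toIso_inv_ι]
    rfl
  have h1 : Proj.toSpecZero 𝒜 x =
      Spec.map (CommRingCat.ofHom (fromZeroRingHom 𝒜 _)) (Proj.basicOpenToSpec 𝒜 1 y) := rfl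
  rw [h1, Spec.map_apply]
  change fromZeroRingHom 𝒜 _ s ∈ (Proj.basicOpenToSpec 𝒜 1 y).asIdeal ↔ _
  rw [fromZeroRingHom]
  change HomogeneousLocalization.mk _ ∈ _ ↔ _
  rw [Proj.mk_mem_basicOpenToSpec_apply, hy]

/-- The **generic point** of `Proj` of a graded domain with nonzero irrelevant ideal: the zero
ideal. [folklore] -/
def Proj.genericPoint [IsDomain A] (h : HomogeneousIdeal.irrelevant 𝒜 ≠ ⊥) : Proj 𝒜 where
  asHomogeneousIdeal := ⊥
  isPrime := by rw [HomogeneousIdeal.toIdeal_bot]; exact Ideal.isPrime_bot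
  not_irrelevant_le hle := h (le_bot_iff.mp hle)

/-- The generic point is dense. [folklore] -/
theorem Proj.dense_genericPoint [IsDomain A] (h : HomogeneousIdeal.irrelevant 𝒜 ≠ ⊥) :
    Dense ({Proj.genericPoint 𝒜 h} : Set (Proj 𝒜)) := by
  intro y
  exact (ProjectiveSpectrum.le_iff_mem_closure _ (Proj.genericPoint 𝒜 h) y).mp
    ((ProjectiveSpectrum.as_ideal_le_as_ideal _ _ _).mp (bot_le : (⊥ : HomogeneousIdeal 𝒜) ≤ _))

end ProjPoints

/-! ## The blowing up is an isomorphism away from `V(I)` -/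

section Away

variable {I}
variable (a : R) (ha : a ∈ I)

/-- The point of `Spec R` under a point `x` of the blowing up: `r ∈ π(x)` iff `r · 1 ∈ x`.
[folklore] -/
theorem affineBlowup.mem_π_apply_iff (x : affineBlowup I) (r : R) :
    r ∈ ((affineBlowup.π I).base x : PrimeSpectrum R).asIdeal ↔
      algebraMap R (reesAlgebra I) r ∈ x.asHomogeneousIdeal := by
  change r ∈ ((Proj.toSpecZero (reesGrading I) ≫
    Spec.map (CommRingCat.ofHom (R := R) (S := reesGrading I 0) (reesGrading.zeroRingHom I))).base x).asIdeal ↔ _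
  rw [Scheme.Hom.comp_apply, Spec.map_apply]
  exact Proj.mem_toSpecZero_apply_iff (reesGrading I) _ (reesGrading.zeroRingHom I r)

/-- **Key lemma**: over `D(a)`, `a ∈ I`, the blowing up lies inside the chart `D₊(at)`: a
relevant homogeneous prime of `R[It]` not containing `a` does not contain `a t` (otherwise
`a · (b tⁿ) = (a t)(b tⁿ⁻¹) ∈ x` forces every `b tⁿ`, `n ≥ 1`, into `x`, i.e. `x` is irrelevant).
[cite: StacksProject, Tag 0804] -/
theorem affineBlowup.reesT_notMem (x : affineBlowup I)
    (hx : algebraMap R (reesAlgebra I) a ∉ x.asHomogeneousIdeal) :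
    reesT a ha ∉ x.asHomogeneousIdeal := by
  classical
  intro hT
  apply x.not_irrelevant_le
  intro z hz
  rw [HomogeneousIdeal.mem_irrelevant_iff, GradedRing.proj_apply] at hz
  change z ∈ x.asHomogeneousIdeal.toIdeal
  rw [← DirectSum.sum_support_decompose (reesGrading I) z]
  refine Ideal.sum_mem _ fun i _ => ?_
  by_cases hi : i = 0
  · subst hi
    rw [hz]
    exact Ideal.zero_mem _
  · -- `z_i = r tⁱ` with `r ∈ Iⁱ`, and `a · z_i = (a t) · (r tⁱ⁻¹)`
    set zi : reesAlgebra I := (DirectSum.decompose (reesGrading I) z i : reesAlgebra I) with hzi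
    obtain ⟨r, hr⟩ := (DirectSum.decompose (reesGrading I) z i).2
    have hr' : (zi : R[X]) = monomial i r := hr.symm
    have hrI : r ∈ I ^ i := by
      have := zi.2 i
      rwa [hr', coeff_monomial, if_pos rfl] at this
    obtain ⟨j, rfl⟩ : ∃ j, i = j + 1 := ⟨i - 1, (Nat.succ_pred_eq_of_ne_zero hi).symm⟩
    let w : reesAlgebra I := ⟨monomial j r, reesAlgebra.monomial_mem.mpr
      (Ideal.pow_le_pow_right (Nat.le_succ j) hrI)⟩
    have hmul : algebraMap R (reesAlgebra I) a * zi = reesT a ha * w := by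
      apply Subtype.ext
      change C a * (zi : R[X]) = monomial 1 a * monomial j r
      rw [hr', C_mul_monomial, monomial_mul_monomial, add_comm]
    have hmem : algebraMap R (reesAlgebra I) a * zi ∈ x.asHomogeneousIdeal.toIdeal := by
      rw [hmul]; exact Ideal.mul_mem_right _ _ hT
    exact ((x.isPrime.mem_or_mem hmem).resolve_left hx)

/-- Hence `π⁻¹(D(a)) ⊆ D₊(at)`. [cite: StacksProject, Tag 0804] -/
theorem affineBlowup.preimage_basicOpen_le :
    affineBlowup.π I ⁻¹ᵁ PrimeSpectrum.basicOpen a ≤ Proj.basicOpen (reesGrading I) (reesT a ha) := by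
  intro x hx
  rw [Proj.mem_basicOpen]
  refine affineBlowup.reesT_notMem a ha x fun h => ?_
  exact hx ((affineBlowup.mem_π_apply_iff x a).mpr h)

/-- **The open immersion `Spec R[1/a] → Bl_I(Spec R)`** (`a ∈ I`): `Spec ψ` followed by the
chart `D₊(at) ≅ Spec (R[It])_{(at)} ⊆ Bl_I(Spec R)`. [cite: StacksProject, Tag 0804] -/
def affineBlowup.awayι : Spec (.of (Localization.Away a)) ⟶ affineBlowup I :=
  Spec.map (CommRingCat.ofHom (reesChart a ha)) ≫
    Proj.awayι (reesGrading I) (reesT a ha) (reesT_mem a ha) one_pos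

/-- `Spec ψ : Spec R[1/a] → Spec (R[It])_{(at)}` is an open immersion (a localization).
[folklore] -/
instance affineBlowup.isOpenImmersion_specMap_reesChart :
    IsOpenImmersion (Spec.map (CommRingCat.ofHom (reesChart a ha))) := by
  letI := (reesChart a ha).toAlgebra
  haveI := isLocalization_reesChart a ha
  exact IsOpenImmersion.of_isLocalization (reesChartBase a ha a)

/-- `Spec R[1/a] → Bl_I(Spec R)` is an open immersion. [folklore] -/
instance affineBlowup.isOpenImmersion_awayι : IsOpenImmersion (affineBlowup.awayι a ha) := by
  unfold affineBlowup.awayι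
  infer_instance

/-- `Spec R[1/a] → Bl_I(Spec R) → Spec R` is the canonical open immersion `Spec R[1/a] → Spec R`.
[cite: StacksProject, Tag 0804] -/
theorem affineBlowup.awayι_π :
    affineBlowup.awayι a ha ≫ affineBlowup.π I =
      Spec.map (CommRingCat.ofHom (algebraMap R (Localization.Away a))) := by
  rw [affineBlowup.awayι, affineBlowup.π, Category.assoc, Proj.awayι_toSpecZero_assoc,
    ← Spec.map_comp, ← Spec.map_comp]
  congr 1
  ext1
  exact reesChart_comp_reesChartBase a ha

/-- The range of the points map of `Spec ψ` is `D(a/1)`. [folklore] -/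
theorem affineBlowup.range_specMap_reesChart :
    Set.range (Spec.map (CommRingCat.ofHom (reesChart a ha))) =
      ((PrimeSpectrum.basicOpen (reesChartBase a ha a) :
        TopologicalSpace.Opens (PrimeSpectrum (Away (reesGrading I) (reesT a ha)))) :
          Set (PrimeSpectrum (Away (reesGrading I) (reesT a ha)))) := by
  letI := (reesChart a ha).toAlgebra
  haveI := isLocalization_reesChart a ha
  exact PrimeSpectrum.localization_away_comap_range (Localization.Away a) (reesChartBase a ha a)

/-- **The range of `Spec R[1/a] → Bl_I(Spec R)` is exactly `π⁻¹(D(a))`.**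
[cite: StacksProject, Tag 0804] -/
theorem affineBlowup.range_awayι :
    Set.range (affineBlowup.awayι a ha) = (affineBlowup.π I ⁻¹ᵁ PrimeSpectrum.basicOpen a : Set _) := by
  apply Set.Subset.antisymm
  · rintro _ ⟨z, rfl⟩
    change affineBlowup.π I (affineBlowup.awayι a ha z) ∈ PrimeSpectrum.basicOpen a
    rw [← Scheme.Hom.comp_apply, affineBlowup.awayι_π]
    have : Spec.map (CommRingCat.ofHom (algebraMap R (Localization.Away a))) z ∈
        (Spec.map (CommRingCat.ofHom (algebraMap R (Localization.Away a)))).opensRange := ⟨z, rfl⟩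
    rwa [Scheme.Hom.opensRange_localizationAway (R := .of R) a] at this
  · intro x hx
    -- `x` lies in the chart `D₊(at)`
    have hx' : x ∈ (Proj.awayι (reesGrading I) (reesT a ha) (reesT_mem a ha) one_pos).opensRange := by
      rw [Proj.opensRange_awayι]
      exact affineBlowup.preimage_basicOpen_le a ha hx
    obtain ⟨y, rfl⟩ := hx'
    -- and the chart point `y` does not contain `a/1`
    have hy : reesChartBase a ha a ∉ y.asIdeal := by
      intro h
      apply hx
      have e := congrArg (fun f => (f y).asIdeal)
        (Proj.awayι_toSpecZero (reesGrading I) (reesT a ha) (reesT_mem a ha) one_pos)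
      simp only [Scheme.Hom.comp_apply, Spec.map_apply] at e
      change a ∈ ((Proj.toSpecZero (reesGrading I) ≫
        Spec.map (CommRingCat.ofHom (R := R) (S := reesGrading I 0) (reesGrading.zeroRingHom I))).base _).asIdeal
      rw [Scheme.Hom.comp_apply, Spec.map_apply, PrimeSpectrum.comap_asIdeal, Ideal.mem_comap, e,
        PrimeSpectrum.comap_asIdeal, Ideal.mem_comap]
      exact h
    have hy' : y ∈ Set.range (Spec.map (CommRingCat.ofHom (reesChart a ha))) := by
      rw [affineBlowup.range_specMap_reesChart]
      exact hy
    obtain ⟨z, rfl⟩ := hy'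
    exact ⟨z, by rw [affineBlowup.awayι, Scheme.Hom.comp_apply]⟩

end Away

/-! ## Isomorphism over `D(a)` and birationality -/

section Iso

/-- **Restriction criterion.** If `j : V → X` is an open immersion with range `π⁻¹(U)` and
`j ≫ π` is an open immersion with range `U`, then `π` is an isomorphism over `U`. [folklore] -/
theorem isIso_morphismRestrict_of_isOpenImmersion {V X Y : Scheme.{u}} (π : X ⟶ Y) (U : Y.Opens)
    (j : V ⟶ X) [IsOpenImmersion j] [IsOpenImmersion (j ≫ π)]
    (hV : Set.range j = (π ⁻¹ᵁ U : Set X)) (hU : Set.range (j ≫ π) = (U : Set Y)) :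
    IsIso (π ∣_ U) := by
  let e := IsOpenImmersion.isoOfRangeEq j (π ⁻¹ᵁ U).ι (hV.trans (Scheme.Opens.range_ι _).symm)
  have he : e.hom ≫ (π ⁻¹ᵁ U).ι = j := IsOpenImmersion.isoOfRangeEq_hom_fac _ _ _
  have h1 : e.hom ≫ (π ∣_ U) ≫ U.ι = j ≫ π := by rw [morphismRestrict_ι, ← Category.assoc, he]
  haveI : IsOpenImmersion (e.hom ≫ (π ∣_ U) ≫ U.ι) := by rw [h1]; infer_instance
  haveI : IsOpenImmersion ((π ∣_ U) ≫ U.ι) := by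
    have : IsOpenImmersion (e.inv ≫ e.hom ≫ (π ∣_ U) ≫ U.ι) := inferInstance
    simpa using this
  haveI : IsOpenImmersion (π ∣_ U) := IsOpenImmersion.of_comp _ U.ι
  have hsurj : Function.Surjective (π ∣_ U) := by
    intro u
    obtain ⟨v, hv⟩ : u.1 ∈ Set.range (j ≫ π) := by rw [hU]; exact u.2
    refine ⟨e.hom v, Subtype.ext ?_⟩
    have := congrArg (fun f : V ⟶ Y => f v) h1
    simp only [Scheme.Hom.comp_apply] at this
    rw [← hv]
    exact this
  haveI : Epi (π ∣_ U).base := (TopCat.epi_iff_surjective _).mpr hsurj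
  exact IsOpenImmersion.isIso (π ∣_ U)

variable {I}

/-- `Spec R[1/a] → Bl_I(Spec R) → Spec R` is an open immersion. [folklore] -/
instance affineBlowup.isOpenImmersion_awayι_π (a : R) (ha : a ∈ I) :
    IsOpenImmersion (affineBlowup.awayι a ha ≫ affineBlowup.π I) := by
  rw [affineBlowup.awayι_π]
  infer_instance

/-- **The blowing up is an isomorphism over `D(a)` for every `a ∈ I`** (hence over the
complement `⋃_{a ∈ I} D(a)` of `V(I)`; Stacks 02OS = Lemma 31.33.4 (1)).
[cite: StacksProject, Tag 02OS] -/
theorem affineBlowup.isIso_morphismRestrict (a : R) (ha : a ∈ I) :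
    IsIso (affineBlowup.π I ∣_ PrimeSpectrum.basicOpen a) := by
  refine isIso_morphismRestrict_of_isOpenImmersion (affineBlowup.π I) _ (affineBlowup.awayι a ha)
    (affineBlowup.range_awayι a ha) ?_
  rw [affineBlowup.awayι_π]
  have := congrArg (fun U : (Spec (.of R)).Opens => (U : Set (Spec (.of R))))
    (Scheme.Hom.opensRange_localizationAway (R := .of R) a)
  exact this

/-- For `0 ≠ a ∈ I` the irrelevant ideal `R[It]₊ ∋ a t` is nonzero. [folklore] -/
theorem irrelevant_reesGrading_ne_bot (a : R) (ha : a ∈ I) (ha0 : a ≠ 0) :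
    HomogeneousIdeal.irrelevant (reesGrading I) ≠ ⊥ := by
  classical
  intro h
  have hT : reesT a ha ∈ HomogeneousIdeal.irrelevant (reesGrading I) := by
    rw [HomogeneousIdeal.mem_irrelevant_iff, GradedRing.proj_apply,
      DirectSum.decompose_of_mem_ne _ (reesT_mem a ha) one_ne_zero]
  rw [h] at hT
  have h0 : reesT a ha = 0 := by
    change reesT a ha ∈ (⊥ : HomogeneousIdeal (reesGrading I)).toIdeal at hT
    rwa [HomogeneousIdeal.toIdeal_bot, Ideal.mem_bot] at hT
  apply ha0
  have := congrArg (fun p : reesAlgebra I => (p : R[X]).coeff 1) h0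
  simpa [coe_reesT] using this


/-- **The blowing up is an isomorphism away from `V(I)`** (Stacks 02OS = Lemma 31.33.4 (1)): over
the open complement `⋃_{a ∈ I} D(a)` of `V(I)` the morphism `π` is an isomorphism (glued from
the `D(a)`, `isIso_morphismRestrict_iSup`). [cite: StacksProject, Tag 02OS] -/
theorem affineBlowup.isIso_morphismRestrict_iSup :
    IsIso (affineBlowup.π I ∣_ ⨆ a : I, (PrimeSpectrum.basicOpen (a : R) : (Spec (.of R)).Opens)) :=
  Literature.AlgebraicGeometry.Resolution.isIso_morphismRestrict_iSup _ _ fun a =>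
    affineBlowup.isIso_morphismRestrict (I := I) a.1 a.2

/-- The open complement of `V(I)` in `Spec R` is `⋃_{a ∈ I} D(a)`. [folklore] -/
theorem iSup_basicOpen_eq_compl_zeroLocus :
    ((⨆ a : I, PrimeSpectrum.basicOpen (a : R) : TopologicalSpace.Opens (PrimeSpectrum R)) :
      Set (PrimeSpectrum R)) = (PrimeSpectrum.zeroLocus (I : Set R))ᶜ := by
  ext p
  rw [Set.mem_compl_iff, SetLike.mem_coe, TopologicalSpace.Opens.mem_iSup,
    PrimeSpectrum.mem_zeroLocus, Set.not_subset]
  constructor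
  · rintro ⟨a, ha⟩
    exact ⟨a, a.2, ha⟩
  · rintro ⟨a, haI, hap⟩
    exact ⟨⟨a, haI⟩, hap⟩

variable [IsDomain R]

/-- The **generic point** of the blowing up of an integral affine scheme along `I ∋ a ≠ 0`.
[folklore] -/
def affineBlowup.genericPoint (a : R) (ha : a ∈ I) (ha0 : a ≠ 0) : affineBlowup I :=
  Proj.genericPoint _ (irrelevant_reesGrading_ne_bot a ha ha0)

/-- The generic point lies over `D(a)`. [folklore] -/
theorem affineBlowup.genericPoint_mem (a : R) (ha : a ∈ I) (ha0 : a ≠ 0) :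
    affineBlowup.genericPoint a ha ha0 ∈ affineBlowup.π I ⁻¹ᵁ PrimeSpectrum.basicOpen a := by
  change a ∉ ((affineBlowup.π I).base _).asIdeal
  rw [affineBlowup.mem_π_apply_iff]
  change algebraMap R (reesAlgebra I) a ∉ (⊥ : HomogeneousIdeal (reesGrading I))
  intro h
  have h0 : algebraMap R (reesAlgebra I) a = 0 := by
    change algebraMap R (reesAlgebra I) a ∈ (⊥ : HomogeneousIdeal (reesGrading I)).toIdeal at h
    rwa [HomogeneousIdeal.toIdeal_bot, Ideal.mem_bot] at h
  apply ha0
  have := congrArg (fun p : reesAlgebra I => (p : R[X]).coeff 0) h0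
  simpa using this

/-- `π⁻¹(D(a))` is dense in the blowing up (`R` a domain, `0 ≠ a ∈ I`). [folklore] -/
theorem affineBlowup.dense_preimage_basicOpen (a : R) (ha : a ∈ I) (ha0 : a ≠ 0) :
    Dense ((affineBlowup.π I ⁻¹ᵁ PrimeSpectrum.basicOpen a : (affineBlowup I).Opens) :
      Set (affineBlowup I)) :=
  (Proj.dense_genericPoint _ (irrelevant_reesGrading_ne_bot a ha ha0)).mono
    (Set.singleton_subset_iff.mpr (affineBlowup.genericPoint_mem a ha ha0))

/-- `D(a)` is dense in `Spec R` (`R` a domain, `a ≠ 0`). [folklore] -/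
theorem dense_basicOpen_of_ne_zero (a : R) (ha0 : a ≠ 0) :
    Dense ((PrimeSpectrum.basicOpen a : TopologicalSpace.Opens (PrimeSpectrum R)) :
      Set (PrimeSpectrum R)) := by
  refine (PrimeSpectrum.basicOpen a).2.dense ⟨⟨⊥, Ideal.isPrime_bot⟩, ?_⟩
  change a ∉ (⊥ : Ideal R)
  simpa using ha0

/-- **The blowing up of an integral affine scheme along a nonzero ideal is birational**
(`IsBirational`: an isomorphism over the dense open `D(a)`, `0 ≠ a ∈ I`, whose preimage is
dense). [cite: StacksProject, Tag 02OS] -/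
theorem affineBlowup.isBirational (hI : I ≠ ⊥) : IsBirational (affineBlowup.π I) := by
  obtain ⟨a, ha, ha0⟩ := Submodule.exists_mem_ne_zero_of_ne_bot hI
  exact ⟨PrimeSpectrum.basicOpen a, dense_basicOpen_of_ne_zero a ha0,
    affineBlowup.dense_preimage_basicOpen a ha ha0, affineBlowup.isIso_morphismRestrict a ha⟩

/-- **The blowing up of a Noetherian integral affine scheme along a nonzero ideal is a proper
birational morphism**; if the blowing up is regular it is a resolution of singularities of
`Spec R` (`IsResolution`). [cite: StacksProject, Tag 02OS] -/
theorem affineBlowup.isResolution [IsNoetherianRing R] (hI : I ≠ ⊥)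
    (hreg : Scheme.IsRegular (affineBlowup I)) : IsResolution (affineBlowup.π I) :=
  ⟨inferInstance, affineBlowup.isBirational hI, hreg⟩

end Iso



end Literature.AlgebraicGeometry.Resolution

end
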